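import Literature.NumberTheory.EllipticCurves.TwoDescentHalvingGalois
import Literature.NumberTheory.EllipticCurves.TwoDescentTwoTorsionCharacter
import HarnessLib

/-!
# The Kummer cocycle of the halves of the `2`-torsion points over `ℂ`: the sign dictionary (D4 of the LEAD line `kummer_diamond`)
(route `ManinLocalTwoThree`, crux C2 `ManinOddAtFour` stmt-BirchSwinnertonDyer-22967; cell bsd-f2-manin, C2/C3 LEAD p1 gen 20;
`--supports stmt-BirchSwinnertonDyer-22967`; line card `Cruxes/ManinOddAtFour/Lines/kummer_diamond.md`, node D4 «2-descent dictionary»)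

For `W/ℚ` with rational `2`-torsion `e₁, e₂, e₃` (`SplitTwoTorsion`, base-changed to `ℂ`), `Tᵢ = (eᵢ, ·) ∈ W(ℂ)` and
`σ ∈ Aut(ℂ/ℚ)` acting on `W(ℂ)` by `Affine.Point.map`:

* `map_halving` — `σ` moves the explicit halving point `Q(u₁,u₂,u₃)` of `TwoDescentHalvingGalois` to `Q(σu₁, σu₂, σu₃)`;
* `exists_halvingCocycle_T₁` — a half `Q₁` of `T₁` (`Q₁ + Q₁ = T₁`) and square roots `w₁ = u₂u₃`, `w₂ = u₂` of the descent pair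
  `d₁ = (e₁−e₂)(e₁−e₃)`, `d₂ = e₁−e₂` of `T₁` such that for every `σ` the cocycle value `κ(σ) = σQ₁ − Q₁` lies in `{0, T₁, T₂, T₃}`,
  `σw₁ = w₁ ↔ κ(σ) ∈ {0, T₁}` and `σw₂ = w₂ ↔ κ(σ) ∈ {0, T₂}` (Silverman AEC X.1, proof of Thm. X.1.1: `σQ − Q` records which
  square roots `σ` negates; `halving_add_twoTorsionᵢ`);
* `exists_halvingCocycle_T₂` — the same for `T₂` with `d₁ = e₂−e₁` (`w₁ = u₁`), `d₂ = (e₂−e₁)(e₂−e₃)` (`w₂ = u₁u₃`).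

This is the E-side «2-descent dictionary» through which p2's `StepTwo.propositionA_complex` output (`h₁`, `h₂`) is read as square
classes (sequel file `…KummerDiamondDescentDictionary`).  UNCONDITIONAL; no definitions, no sorry.  Nothing about E-es-185, C2, Manin's
conjecture or BSD is proved here.  [cite: SilvermanAEC2009, Thm. X.1.1 and Prop. X.1.4] [cite: Knapp1993, Thm. 4.2]
-/

set_option autoImplicit false
-- lint-debt: the directory name repeats the summit name (sibling precedent `ManinLocalTwoThreeKummerDiamondKummerSubgroup.lean`)
set_option linter.dupNamespace false

noncomputable section

open scoped Classical
open WeierstrassCurve WeierstrassCurve.Affine WeierstrassCurve.Affine.Point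

namespace Summit.BirchSwinnertonDyer.BirchSwinnertonDyer.Theorems.ManinLocalTwoThree.HalvingCocycle

variable {W : WeierstrassCurve ℚ} [W.IsElliptic] {e₁ e₂ e₃ : ℚ}

/-! ## §1 Base change of the split `2`-torsion and the Galois action on the halving point -/

omit [W.IsElliptic] in
/-- Rational `2`-torsion base-changes to `ℂ`. [cite: SilvermanAEC2009, Prop. X.1.4] -/
theorem splitTwoTorsion_complex (h : W.toAffine.SplitTwoTorsion e₁ e₂ e₃) :
    (W.baseChange ℂ).toAffine.SplitTwoTorsion (e₁ : ℂ) (e₂ : ℂ) (e₃ : ℂ) := by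
  have h' := h.map ℂ
  simp only [eq_ratCast] at h'
  exact h'

/-- An automorphism of `ℂ/ℚ` sends a square root of a rational number to `±` itself. [folklore] -/
theorem algEquiv_apply_eq_or_eq_neg (σ : ℂ ≃ₐ[ℚ] ℂ) {u : ℂ} {d : ℚ} (hu : u ^ 2 = (d : ℂ)) :
    σ u = u ∨ σ u = -u := by
  rw [← sq_eq_sq_iff_eq_or_eq_neg, ← map_pow, hu, map_ratCast]

/-- **`σ Q(u₁, u₂, u₃) = Q(σu₁, σu₂, σu₃)`** for the explicit halving point of a point with rational abscissa `x₀` (its coordinates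
are `ℚ`-polynomials in the `uᵢ`). [cite: SilvermanAEC2009, Thm. X.1.1] -/
theorem map_halving (hC : (W.baseChange ℂ).toAffine.SplitTwoTorsion (e₁ : ℂ) (e₂ : ℂ) (e₃ : ℂ)) (σ : ℂ ≃ₐ[ℚ] ℂ) {x₀ : ℚ}
    {u₁ u₂ u₃ v₁ v₂ v₃ : ℂ}
    (hu₁ : (x₀ : ℂ) - (e₁ : ℂ) = u₁ ^ 2) (hu₂ : (x₀ : ℂ) - (e₂ : ℂ) = u₂ ^ 2) (hu₃ : (x₀ : ℂ) - (e₃ : ℂ) = u₃ ^ 2)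
    (hv₁ : (x₀ : ℂ) - (e₁ : ℂ) = v₁ ^ 2) (hv₂ : (x₀ : ℂ) - (e₂ : ℂ) = v₂ ^ 2) (hv₃ : (x₀ : ℂ) - (e₃ : ℂ) = v₃ ^ 2)
    (h₁ : σ u₁ = v₁) (h₂ : σ u₂ = v₂) (h₃ : σ u₃ = v₃) :
    Affine.Point.map (W' := W) (σ : ℂ →ₐ[ℚ] ℂ) (.some _ _ (nonsingular_halving hC hu₁ hu₂ hu₃)) =
      .some _ _ (nonsingular_halving hC hv₁ hv₂ hv₃) := by
  rw [Affine.Point.map_some]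
  simp only [Affine.Point.some.injEq]
  have ha₁ : (σ : ℂ →ₐ[ℚ] ℂ) (W.baseChange ℂ).toAffine.a₁ = (W.baseChange ℂ).toAffine.a₁ := by
    rw [show (W.baseChange ℂ).toAffine.a₁ = (W.a₁ : ℂ) by simp [WeierstrassCurve.baseChange, WeierstrassCurve.map_a₁]]
    exact map_ratCast _ _
  have ha₃ : (σ : ℂ →ₐ[ℚ] ℂ) (W.baseChange ℂ).toAffine.a₃ = (W.baseChange ℂ).toAffine.a₃ := by
    rw [show (W.baseChange ℂ).toAffine.a₃ = (W.a₃ : ℂ) by simp [WeierstrassCurve.baseChange, WeierstrassCurve.map_a₃]]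
    exact map_ratCast _ _
  have hx₀ : (σ : ℂ →ₐ[ℚ] ℂ) (x₀ : ℂ) = (x₀ : ℂ) := map_ratCast _ _
  have h₁' : (σ : ℂ →ₐ[ℚ] ℂ) u₁ = v₁ := h₁
  have h₂' : (σ : ℂ →ₐ[ℚ] ℂ) u₂ = v₂ := h₂
  have h₃' : (σ : ℂ →ₐ[ℚ] ℂ) u₃ = v₃ := h₃
  constructor
  · simp only [map_add, map_mul, hx₀, h₁', h₂', h₃']
  · simp only [map_sub, map_div₀, map_add, map_mul, map_ofNat, hx₀, h₁', h₂', h₃', ha₁, ha₃]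

/-! ## §2 The cocycle of a half of `T₁` -/

/-- **The Kummer cocycle of a half of `T₁ = (e₁, ·)`.**  There are a half `Q₁ ∈ W(ℂ)` of `T₁` and square roots `w₁` of
`d₁ = (e₁−e₂)(e₁−e₃)` and `w₂` of `d₂ = e₁−e₂` (the `2`-descent pair of `T₁`), both non-zero, such that for every `σ ∈ Aut(ℂ/ℚ)`:
`σQ₁ − Q₁ ∈ {0, T₁, T₂, T₃}`, `σw₁ = w₁ ↔ σQ₁ − Q₁ ∈ {0, T₁}`, and `σw₂ = w₂ ↔ σQ₁ − Q₁ ∈ {0, T₂}`.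
(`Q₁ = Q(0, u₂, u₃)` with `u₂² = e₁−e₂`, `u₃² = e₁−e₃`, `w₁ = u₂u₃`, `w₂ = u₂`; `σ` flips an arbitrary subset of `{u₂, u₃}` and
`Q(0, −u₂, −u₃) = Q₁ + T₁`, `Q(0, u₂, −u₃) = Q₁ + T₂`, `Q(0, −u₂, u₃) = Q₁ + T₃`.) [cite: SilvermanAEC2009, Thm. X.1.1 and Prop. X.1.4] -/
theorem exists_halvingCocycle_T₁ (hC : (W.baseChange ℂ).toAffine.SplitTwoTorsion (e₁ : ℂ) (e₂ : ℂ) (e₃ : ℂ)) :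
    ∃ (Q : (W.baseChange ℂ).toAffine.Point) (w₁ w₂ : ℂ),
      Q + Q = .some _ _ (nonsingular_twoTorsion hC) ∧
      w₁ ^ 2 = (((e₁ - e₂) * (e₁ - e₃) : ℚ) : ℂ) ∧ w₂ ^ 2 = ((e₁ - e₂ : ℚ) : ℂ) ∧ w₁ ≠ 0 ∧ w₂ ≠ 0 ∧
      ∀ σ : ℂ ≃ₐ[ℚ] ℂ,
        (Affine.Point.map (W' := W) (σ : ℂ →ₐ[ℚ] ℂ) Q - Q = 0 ∨
          Affine.Point.map (W' := W) (σ : ℂ →ₐ[ℚ] ℂ) Q - Q = .some _ _ (nonsingular_twoTorsion hC) ∨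
          Affine.Point.map (W' := W) (σ : ℂ →ₐ[ℚ] ℂ) Q - Q = .some _ _ (nonsingular_twoTorsion hC.swap₁₂) ∨
          Affine.Point.map (W' := W) (σ : ℂ →ₐ[ℚ] ℂ) Q - Q = .some _ _ (nonsingular_twoTorsion hC.swap₂₃.swap₁₂)) ∧
        (σ w₁ = w₁ ↔ (Affine.Point.map (W' := W) (σ : ℂ →ₐ[ℚ] ℂ) Q - Q = 0 ∨
          Affine.Point.map (W' := W) (σ : ℂ →ₐ[ℚ] ℂ) Q - Q = .some _ _ (nonsingular_twoTorsion hC))) ∧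
        (σ w₂ = w₂ ↔ (Affine.Point.map (W' := W) (σ : ℂ →ₐ[ℚ] ℂ) Q - Q = 0 ∨
          Affine.Point.map (W' := W) (σ : ℂ →ₐ[ℚ] ℂ) Q - Q = .some _ _ (nonsingular_twoTorsion hC.swap₁₂))) := by
  -- square roots
  obtain ⟨u₂, hu₂'⟩ := IsAlgClosed.exists_eq_mul_self ((e₁ : ℂ) - (e₂ : ℂ))
  obtain ⟨u₃, hu₃'⟩ := IsAlgClosed.exists_eq_mul_self ((e₁ : ℂ) - (e₃ : ℂ))
  have hu₁ : (e₁ : ℂ) - (e₁ : ℂ) = (0 : ℂ) ^ 2 := by ring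
  have hu₂ : (e₁ : ℂ) - (e₂ : ℂ) = u₂ ^ 2 := by rw [hu₂']; ring
  have hu₃ : (e₁ : ℂ) - (e₃ : ℂ) = u₃ ^ 2 := by rw [hu₃']; ring
  have hu₂n : (e₁ : ℂ) - (e₂ : ℂ) = (-u₂) ^ 2 := by rw [hu₂]; ring
  have hu₃n : (e₁ : ℂ) - (e₃ : ℂ) = (-u₃) ^ 2 := by rw [hu₃]; ring
  have hu₁n : (e₁ : ℂ) - (e₁ : ℂ) = (-0 : ℂ) ^ 2 := by ring
  have h12 : (e₁ : ℂ) ≠ e₂ := hC.ne₁₂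
  have h13 : (e₁ : ℂ) ≠ e₃ := hC.ne₁₃
  have hu₂0 : u₂ ≠ 0 := by
    intro h; apply h12; have := hu₂; rw [h] at this; linear_combination this
  have hu₃0 : u₃ ≠ 0 := by
    intro h; apply h13; have := hu₃; rw [h] at this; linear_combination this
  -- the points
  set T₁ : (W.baseChange ℂ).toAffine.Point := .some _ _ (nonsingular_twoTorsion hC) with hT₁
  set T₂ : (W.baseChange ℂ).toAffine.Point := .some _ _ (nonsingular_twoTorsion hC.swap₁₂) with hT₂
  set T₃ : (W.baseChange ℂ).toAffine.Point := .some _ _ (nonsingular_twoTorsion hC.swap₂₃.swap₁₂) with hT₃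
  set Q : (W.baseChange ℂ).toAffine.Point := .some _ _ (nonsingular_halving hC hu₁ hu₂ hu₃) with hQ
  have hT₁0 : T₁ ≠ 0 := Affine.Point.some_ne_zero _
  have hT₂0 : T₂ ≠ 0 := Affine.Point.some_ne_zero _
  have hT₃0 : T₃ ≠ 0 := Affine.Point.some_ne_zero _
  have hT₂₁ : T₂ ≠ T₁ := fun h ↦ h12 (by rw [hT₂, hT₁, Affine.Point.some.injEq] at h; exact h.1.symm)
  have hT₃₁ : T₃ ≠ T₁ := fun h ↦ h13 (by rw [hT₃, hT₁, Affine.Point.some.injEq] at h; exact h.1.symm)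
  have hT₃₂ : T₃ ≠ T₂ := fun h ↦ hC.ne₂₃ (by rw [hT₃, hT₂, Affine.Point.some.injEq] at h; exact h.1.symm)
  -- `2Q = T₁`
  have h2Q : Q + Q = T₁ := by
    rw [hQ, hT₁]
    refine halving_add_self hC (nonsingular_twoTorsion hC) hu₁ hu₂ hu₃ ?_
    rw [twoTorsionY]; ring
  -- translates
  have hQT₁ : Q + T₁ = .some _ _ (nonsingular_halving hC hu₁ hu₂n hu₃n) := halving_add_twoTorsion₁ hC hu₁ hu₂ hu₃
  have hQT₂ : Q + T₂ = .some _ _ (nonsingular_halving hC hu₁n hu₂ hu₃n) := halving_add_twoTorsion₂ hC hu₁ hu₂ hu₃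
  have hQT₃ : Q + T₃ = .some _ _ (nonsingular_halving hC hu₁n hu₂n hu₃) := halving_add_twoTorsion₃ hC hu₁ hu₂ hu₃
  refine ⟨Q, u₂ * u₃, u₂, h2Q, by push_cast; rw [hu₂, hu₃]; ring, by push_cast; rw [hu₂], mul_ne_zero hu₂0 hu₃0, hu₂0,
    fun σ ↦ ?_⟩
  have hd₂ : u₂ ^ 2 = ((e₁ - e₂ : ℚ) : ℂ) := by push_cast; rw [hu₂]
  have hd₃ : u₃ ^ 2 = ((e₁ - e₃ : ℚ) : ℂ) := by push_cast; rw [hu₃]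
  have hσ0 : σ (0 : ℂ) = 0 := _root_.map_zero σ
  have hσ0' : σ (0 : ℂ) = -0 := by rw [_root_.map_zero, _root_.neg_zero]
  -- `-a = a ↔ a = 0` bookkeeping
  have hneg : ∀ {a : ℂ}, a ≠ 0 → -a ≠ a := fun {a} ha h ↦ ha (by linear_combination -h / 2)
  rcases algEquiv_apply_eq_or_eq_neg σ hd₂ with h2 | h2 <;> rcases algEquiv_apply_eq_or_eq_neg σ hd₃ with h3 | h3
  · -- no flips: `σQ = Q`
    have hκ : Affine.Point.map (W' := W) (σ : ℂ →ₐ[ℚ] ℂ) Q - Q = 0 := by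
      rw [sub_eq_zero, hQ]; exact map_halving hC σ hu₁ hu₂ hu₃ hu₁ hu₂ hu₃ hσ0 h2 h3
    refine ⟨Or.inl hκ, ⟨fun _ ↦ Or.inl hκ, fun _ ↦ by rw [map_mul, h2, h3]⟩, ⟨fun _ ↦ Or.inl hκ, fun _ ↦ h2⟩⟩
  · -- flip `u₃` only: `σQ = Q + T₂`
    have hκ : Affine.Point.map (W' := W) (σ : ℂ →ₐ[ℚ] ℂ) Q - Q = T₂ := by
      rw [sub_eq_iff_eq_add', hQT₂, hQ]; exact map_halving hC σ hu₁ hu₂ hu₃ hu₁n hu₂ hu₃n hσ0' h2 h3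
    refine ⟨Or.inr (Or.inr (Or.inl hκ)), ⟨fun h ↦ ?_, fun h ↦ ?_⟩, ⟨fun _ ↦ Or.inr hκ, fun _ ↦ h2⟩⟩
    · exfalso; rw [map_mul, h2, h3] at h
      exact hneg (mul_ne_zero hu₂0 hu₃0) (by linear_combination h)
    · exfalso; rw [hκ] at h; rcases h with h | h; exacts [hT₂0 h, hT₂₁ h]
  · -- flip `u₂` only: `σQ = Q + T₃`
    have hκ : Affine.Point.map (W' := W) (σ : ℂ →ₐ[ℚ] ℂ) Q - Q = T₃ := by
      rw [sub_eq_iff_eq_add', hQT₃, hQ]; exact map_halving hC σ hu₁ hu₂ hu₃ hu₁n hu₂n hu₃ hσ0' h2 h3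
    refine ⟨Or.inr (Or.inr (Or.inr hκ)), ⟨fun h ↦ ?_, fun h ↦ ?_⟩, ⟨fun h ↦ ?_, fun h ↦ ?_⟩⟩
    · exfalso; rw [map_mul, h2, h3] at h
      exact hneg (mul_ne_zero hu₂0 hu₃0) (by linear_combination h)
    · exfalso; rw [hκ] at h; rcases h with h | h; exacts [hT₃0 h, hT₃₁ h]
    · exfalso; exact hneg hu₂0 (by rw [← h2]; exact h)
    · exfalso; rw [hκ] at h; rcases h with h | h; exacts [hT₃0 h, hT₃₂ h]
  · -- flip both: `σQ = Q + T₁`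
    have hκ : Affine.Point.map (W' := W) (σ : ℂ →ₐ[ℚ] ℂ) Q - Q = T₁ := by
      rw [sub_eq_iff_eq_add', hQT₁, hQ]; exact map_halving hC σ hu₁ hu₂ hu₃ hu₁ hu₂n hu₃n hσ0 h2 h3
    refine ⟨Or.inr (Or.inl hκ), ⟨fun _ ↦ Or.inr hκ, fun _ ↦ by rw [map_mul, h2, h3]; ring⟩, ⟨fun h ↦ ?_, fun h ↦ ?_⟩⟩
    · exfalso; exact hneg hu₂0 (by rw [← h2]; exact h)
    · exfalso; rw [hκ] at h; rcases h with h | h; exacts [hT₁0 h, hT₂₁ h.symm]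

/-! ## §3 The cocycle of a half of `T₂` -/

/-- **The Kummer cocycle of a half of `T₂ = (e₂, ·)`.**  There are a half `Q₂ ∈ W(ℂ)` of `T₂` and square roots `w₁` of `d₁ = e₂−e₁`
and `w₂` of `d₂ = (e₂−e₁)(e₂−e₃)` (the `2`-descent pair of `T₂`), both non-zero, with, for every `σ ∈ Aut(ℂ/ℚ)`:
`σQ₂ − Q₂ ∈ {0, T₁, T₂, T₃}`, `σw₁ = w₁ ↔ σQ₂ − Q₂ ∈ {0, T₁}`, `σw₂ = w₂ ↔ σQ₂ − Q₂ ∈ {0, T₂}`.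
(`Q₂ = Q(u₁, 0, u₃)`, `w₁ = u₁`, `w₂ = u₁u₃`.) [cite: SilvermanAEC2009, Thm. X.1.1 and Prop. X.1.4] -/
theorem exists_halvingCocycle_T₂ (hC : (W.baseChange ℂ).toAffine.SplitTwoTorsion (e₁ : ℂ) (e₂ : ℂ) (e₃ : ℂ)) :
    ∃ (Q : (W.baseChange ℂ).toAffine.Point) (w₁ w₂ : ℂ),
      Q + Q = .some _ _ (nonsingular_twoTorsion hC.swap₁₂) ∧
      w₁ ^ 2 = ((e₂ - e₁ : ℚ) : ℂ) ∧ w₂ ^ 2 = (((e₂ - e₁) * (e₂ - e₃) : ℚ) : ℂ) ∧ w₁ ≠ 0 ∧ w₂ ≠ 0 ∧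
      ∀ σ : ℂ ≃ₐ[ℚ] ℂ,
        (Affine.Point.map (W' := W) (σ : ℂ →ₐ[ℚ] ℂ) Q - Q = 0 ∨
          Affine.Point.map (W' := W) (σ : ℂ →ₐ[ℚ] ℂ) Q - Q = .some _ _ (nonsingular_twoTorsion hC) ∨
          Affine.Point.map (W' := W) (σ : ℂ →ₐ[ℚ] ℂ) Q - Q = .some _ _ (nonsingular_twoTorsion hC.swap₁₂) ∨
          Affine.Point.map (W' := W) (σ : ℂ →ₐ[ℚ] ℂ) Q - Q = .some _ _ (nonsingular_twoTorsion hC.swap₂₃.swap₁₂)) ∧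
        (σ w₁ = w₁ ↔ (Affine.Point.map (W' := W) (σ : ℂ →ₐ[ℚ] ℂ) Q - Q = 0 ∨
          Affine.Point.map (W' := W) (σ : ℂ →ₐ[ℚ] ℂ) Q - Q = .some _ _ (nonsingular_twoTorsion hC))) ∧
        (σ w₂ = w₂ ↔ (Affine.Point.map (W' := W) (σ : ℂ →ₐ[ℚ] ℂ) Q - Q = 0 ∨
          Affine.Point.map (W' := W) (σ : ℂ →ₐ[ℚ] ℂ) Q - Q = .some _ _ (nonsingular_twoTorsion hC.swap₁₂))) := by
  obtain ⟨u₁, hu₁'⟩ := IsAlgClosed.exists_eq_mul_self ((e₂ : ℂ) - (e₁ : ℂ))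
  obtain ⟨u₃, hu₃'⟩ := IsAlgClosed.exists_eq_mul_self ((e₂ : ℂ) - (e₃ : ℂ))
  have hu₁ : (e₂ : ℂ) - (e₁ : ℂ) = u₁ ^ 2 := by rw [hu₁']; ring
  have hu₂ : (e₂ : ℂ) - (e₂ : ℂ) = (0 : ℂ) ^ 2 := by ring
  have hu₃ : (e₂ : ℂ) - (e₃ : ℂ) = u₃ ^ 2 := by rw [hu₃']; ring
  have hu₁n : (e₂ : ℂ) - (e₁ : ℂ) = (-u₁) ^ 2 := by rw [hu₁]; ring
  have hu₃n : (e₂ : ℂ) - (e₃ : ℂ) = (-u₃) ^ 2 := by rw [hu₃]; ring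
  have hu₂n : (e₂ : ℂ) - (e₂ : ℂ) = (-0 : ℂ) ^ 2 := by ring
  have h12 : (e₁ : ℂ) ≠ e₂ := hC.ne₁₂
  have h23 : (e₂ : ℂ) ≠ e₃ := hC.ne₂₃
  have hu₁0 : u₁ ≠ 0 := by
    intro h; apply h12; have := hu₁; rw [h] at this; linear_combination -this
  have hu₃0 : u₃ ≠ 0 := by
    intro h; apply h23; have := hu₃; rw [h] at this; linear_combination this
  set T₁ : (W.baseChange ℂ).toAffine.Point := .some _ _ (nonsingular_twoTorsion hC) with hT₁
  set T₂ : (W.baseChange ℂ).toAffine.Point := .some _ _ (nonsingular_twoTorsion hC.swap₁₂) with hT₂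
  set T₃ : (W.baseChange ℂ).toAffine.Point := .some _ _ (nonsingular_twoTorsion hC.swap₂₃.swap₁₂) with hT₃
  set Q : (W.baseChange ℂ).toAffine.Point := .some _ _ (nonsingular_halving hC hu₁ hu₂ hu₃) with hQ
  have hT₁0 : T₁ ≠ 0 := Affine.Point.some_ne_zero _
  have hT₂0 : T₂ ≠ 0 := Affine.Point.some_ne_zero _
  have hT₃0 : T₃ ≠ 0 := Affine.Point.some_ne_zero _
  have hT₂₁ : T₂ ≠ T₁ := fun h ↦ h12 (by rw [hT₂, hT₁, Affine.Point.some.injEq] at h; exact h.1.symm)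
  have hT₃₁ : T₃ ≠ T₁ := fun h ↦ hC.ne₁₃ (by rw [hT₃, hT₁, Affine.Point.some.injEq] at h; exact h.1.symm)
  have hT₃₂ : T₃ ≠ T₂ := fun h ↦ h23 (by rw [hT₃, hT₂, Affine.Point.some.injEq] at h; exact h.1.symm)
  have h2Q : Q + Q = T₂ := by
    rw [hQ, hT₂]
    refine halving_add_self hC (nonsingular_twoTorsion hC.swap₁₂) hu₁ hu₂ hu₃ ?_
    rw [twoTorsionY]; ring
  have hQT₁ : Q + T₁ = .some _ _ (nonsingular_halving hC hu₁ hu₂n hu₃n) := halving_add_twoTorsion₁ hC hu₁ hu₂ hu₃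
  have hQT₂ : Q + T₂ = .some _ _ (nonsingular_halving hC hu₁n hu₂ hu₃n) := halving_add_twoTorsion₂ hC hu₁ hu₂ hu₃
  have hQT₃ : Q + T₃ = .some _ _ (nonsingular_halving hC hu₁n hu₂n hu₃) := halving_add_twoTorsion₃ hC hu₁ hu₂ hu₃
  refine ⟨Q, u₁, u₁ * u₃, h2Q, by push_cast; rw [hu₁], by push_cast; rw [hu₁, hu₃]; ring, hu₁0, mul_ne_zero hu₁0 hu₃0,
    fun σ ↦ ?_⟩
  have hd₁ : u₁ ^ 2 = ((e₂ - e₁ : ℚ) : ℂ) := by push_cast; rw [hu₁]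
  have hd₃ : u₃ ^ 2 = ((e₂ - e₃ : ℚ) : ℂ) := by push_cast; rw [hu₃]
  have hσ0 : σ (0 : ℂ) = 0 := _root_.map_zero σ
  have hσ0' : σ (0 : ℂ) = -0 := by rw [_root_.map_zero, _root_.neg_zero]
  have hneg : ∀ {a : ℂ}, a ≠ 0 → -a ≠ a := fun {a} ha h ↦ ha (by linear_combination -h / 2)
  rcases algEquiv_apply_eq_or_eq_neg σ hd₁ with h1 | h1 <;> rcases algEquiv_apply_eq_or_eq_neg σ hd₃ with h3 | h3
  · -- no flips
    have hκ : Affine.Point.map (W' := W) (σ : ℂ →ₐ[ℚ] ℂ) Q - Q = 0 := by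
      rw [sub_eq_zero, hQ]; exact map_halving hC σ hu₁ hu₂ hu₃ hu₁ hu₂ hu₃ h1 hσ0 h3
    refine ⟨Or.inl hκ, ⟨fun _ ↦ Or.inl hκ, fun _ ↦ h1⟩, ⟨fun _ ↦ Or.inl hκ, fun _ ↦ by rw [map_mul, h1, h3]⟩⟩
  · -- flip `u₃` only: `σQ = Q + T₁`
    have hκ : Affine.Point.map (W' := W) (σ : ℂ →ₐ[ℚ] ℂ) Q - Q = T₁ := by
      rw [sub_eq_iff_eq_add', hQT₁, hQ]; exact map_halving hC σ hu₁ hu₂ hu₃ hu₁ hu₂n hu₃n h1 hσ0' h3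
    refine ⟨Or.inr (Or.inl hκ), ⟨fun _ ↦ Or.inr hκ, fun _ ↦ h1⟩, ⟨fun h ↦ ?_, fun h ↦ ?_⟩⟩
    · exfalso; rw [map_mul, h1, h3] at h
      exact hneg (mul_ne_zero hu₁0 hu₃0) (by linear_combination h)
    · exfalso; rw [hκ] at h; rcases h with h | h; exacts [hT₁0 h, hT₂₁ h.symm]
  · -- flip `u₁` only: `σQ = Q + T₃`
    have hκ : Affine.Point.map (W' := W) (σ : ℂ →ₐ[ℚ] ℂ) Q - Q = T₃ := by
      rw [sub_eq_iff_eq_add', hQT₃, hQ]; exact map_halving hC σ hu₁ hu₂ hu₃ hu₁n hu₂n hu₃ h1 hσ0' h3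
    refine ⟨Or.inr (Or.inr (Or.inr hκ)), ⟨fun h ↦ ?_, fun h ↦ ?_⟩, ⟨fun h ↦ ?_, fun h ↦ ?_⟩⟩
    · exfalso; exact hneg hu₁0 (by rw [← h1]; exact h)
    · exfalso; rw [hκ] at h; rcases h with h | h; exacts [hT₃0 h, hT₃₁ h]
    · exfalso; rw [map_mul, h1, h3] at h
      exact hneg (mul_ne_zero hu₁0 hu₃0) (by linear_combination h)
    · exfalso; rw [hκ] at h; rcases h with h | h; exacts [hT₃0 h, hT₃₂ h]
  · -- flip both: `σQ = Q + T₂`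
    have hκ : Affine.Point.map (W' := W) (σ : ℂ →ₐ[ℚ] ℂ) Q - Q = T₂ := by
      rw [sub_eq_iff_eq_add', hQT₂, hQ]; exact map_halving hC σ hu₁ hu₂ hu₃ hu₁n hu₂ hu₃n h1 hσ0 h3
    refine ⟨Or.inr (Or.inr (Or.inl hκ)), ⟨fun h ↦ ?_, fun h ↦ ?_⟩, ⟨fun _ ↦ Or.inr hκ, fun _ ↦ by rw [map_mul, h1, h3]; ring⟩⟩
    · exfalso; exact hneg hu₁0 (by rw [← h1]; exact h)
    · exfalso; rw [hκ] at h; rcases h with h | h; exacts [hT₂0 h, hT₂₁ h]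

end Summit.BirchSwinnertonDyer.BirchSwinnertonDyer.Theorems.ManinLocalTwoThree.HalvingCocycle

end
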